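import Summits.Ventures.PercRepro.RankDistEarsFamilyAll
import Summits.Ventures.PercRepro.RankDistEarsBottomCount

/-!
# PercRepro — THE REPAIRED ROW (BC) AND C-025 HOLD ON THE WHOLE FAMILY `C₄ + (1, k, k, k)`, IN THE KERNEL (p9, gen 24)

On the infinite family where the row (SC) fails for every `k ≥ 6` (`RankDistEarsFamilyAll`), the repaired row (BC)
`BottomCumulativeTop` holds for EVERY `k ≥ 1` — unconditionally, as a kernel theorem (`bottomCumulativeTop_kFam`), and
with it C-025 (`rls_kFam`). The ends `v = q`, `v = p` are the tree's `card_Uq_le_card_shadowLev` and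
`card_Uq_le_card_shadowLev_top`; the interior level `v = q + 1` needs the bottom count `#𝓑 = (3k² + 12k + 11)·c³`
(`bottomSum_closed`, by the symbolic expansion of `RankDistEarsFamilyAll`) against `s_{q+1}` (`levelSum_q1_closed`):
`(3k + 4)·#𝓑 ≤ (3k + 3)·s_{q+1}`, from `c ≤ b` and `91·k·8^k ≤ 18·27^k` for `k ≥ 2` (`k = 1` by `decide`). So (BC)
= C-049 is the row that survives exactly where (SC) dies, with slack `≈ 3^k`. Nothing here moves any window of the crux.
-/

namespace PercRepro.RankDist

open Set Finset _root_.Matroid PercRepro.ThmH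

/-- The bottom summand at `X`, as a function of the four host types. -/
def H4b (k : ℕ) (X : Finset (Fin 4)) (t0 t1 t2 t3 : Bool × Bool) : ℕ :=
  if bottomCond X ![t0, t1, t2, t3] then hostCount 1 t0 * hostCount k t1 * hostCount k t2 * hostCount k t3 else 0

/-- The bottom summand at `X` depends on the four host types only. -/
lemma summand_eq_b (k : ℕ) (X : Finset (Fin 4)) (T : Fin 4 → Bool × Bool) :
    (if bottomCond X T then ∏ j, hostCount (kFam k j) (T j) else 0) = H4b k X (T 0) (T 1) (T 2) (T 3) := by
  unfold H4b
  rw [Fin.prod_univ_four]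
  simp only [kFam, Matrix.cons_val_zero, Matrix.cons_val_one, Matrix.head_cons, Matrix.cons_val_two,
    Matrix.tail_cons]
  have e : ![T 0, T 1, T 2, T 3] = T := (fin4_eta T).symm
  rw [e]
  congr 2

set_option maxHeartbeats 4000000 in
/-- **THE BOTTOM COUNT OF `C₄ + (1, k, k, k)`**, `k = m + 1`: `#𝓑 = (3k² + 12k + 11)·c³` with `c = 2^k`. -/
theorem bottomSum_closed (m : ℕ) :
    bottomSum (kFam (m + 1)) = (3 * (m + 1) ^ 2 + 12 * (m + 1) + 11) * (2 ^ (m + 1)) ^ 3 := by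
  unfold bottomSum
  rw [sum_finset_fin4]
  simp only [summand_eq_b, sum_fun_fin4, Fintype.sum_prod_type, Fintype.sum_bool]
  simp (config := {decide := true}) only [H4b, hostCount, if_true, if_false, Nat.add_sub_cancel]
  ring

/-- `91·k·8^k ≤ 18·27^k` for `k ≥ 2`. -/
lemma exp_dom (k : ℕ) (hk : 2 ≤ k) : 91 * k * 8 ^ k ≤ 18 * 27 ^ k := by
  induction k, hk using Nat.le_induction with
  | base => norm_num
  | succ k hk ih =>
    have h27 : 27 ^ (k + 1) = 27 * 27 ^ k := by rw [pow_succ]; ring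
    have h8 : 8 ^ (k + 1) = 8 * 8 ^ k := by rw [pow_succ]; ring
    rw [h27, h8]
    nlinarith [ih, Nat.zero_le (8 ^ k)]

/-- **The interior level of (BC) on the family**: `(3k + 4)·#𝓑 ≤ (3k + 3)·s_{q+1}` for every `k ≥ 1`. -/
theorem family_bc_interior (k : ℕ) (hk : 1 ≤ k) :
    (3 * k + 4) * bottomSum (kFam k) ≤ (3 * k + 3) * levelSum (kFam k) (3 * k + 3) := by
  obtain ⟨m, rfl⟩ : ∃ m, k = m + 1 := ⟨k - 1, by omega⟩
  rcases Nat.lt_or_ge m 1 with hm | hm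
  · have : m = 0 := by omega
    subst this
    set_option maxRecDepth 200000 in decide +kernel
  · have hB := bottomSum_closed m
    have h1 := levelSum_q1_closed m
    set S1 := levelSum (kFam (m + 1)) (3 * (m + 1) + 3) with hS1
    set x := 3 ^ m with hx
    set y := 2 ^ m with hy
    have hb : 3 ^ (m + 1) = 3 * x := by rw [pow_succ, hx]; ring
    have hc : 2 ^ (m + 1) = 2 * y := by rw [pow_succ, hy]; ring
    rw [hb, hc] at h1
    rw [hc] at hB
    rw [hB]
    have hyx : y ≤ x := Nat.pow_le_pow_left (by norm_num) m
    have hx27 : x ^ 3 = 27 ^ m := by rw [hx, ← pow_mul, show 27 = 3 ^ 3 by norm_num, ← pow_mul, mul_comm]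
    have hy8 : y ^ 3 = 8 ^ m := by rw [hy, ← pow_mul, show 8 = 2 ^ 3 by norm_num, ← pow_mul, mul_comm]
    have hdom := exp_dom (m + 1) (by omega)
    rw [pow_succ, pow_succ, ← hx27, ← hy8] at hdom
    -- hdom : 91 * (m + 1) * (y ^ 3 * 8) ≤ 18 * (x ^ 3 * 27)
    have hxy2 : x * y ^ 2 ≤ x ^ 3 := by
      have : y ^ 2 ≤ x ^ 2 := Nat.pow_le_pow_left hyx 2
      calc x * y ^ 2 ≤ x * x ^ 2 := Nat.mul_le_mul_left _ this
        _ = x ^ 3 := by ring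
    have hx2y : x ^ 2 * y ≤ x ^ 3 := by
      calc x ^ 2 * y ≤ x ^ 2 * x := Nat.mul_le_mul_left _ hyx
        _ = x ^ 3 := by ring
    have hy3 : y ^ 3 ≤ x ^ 3 := Nat.pow_le_pow_left hyx 3
    -- S1 ≥ (14k − 2)·b³ − … : from h1, S1 + N = P with N ≤ (7k + 9)·27x³ and P ≥ (21k + 7)·27x³
    nlinarith [h1, hxy2, hx2y, hy3, hdom, Nat.zero_le (m * (x * y ^ 2)), Nat.zero_le (m * (x ^ 2 * y)),
      Nat.zero_le (m * x ^ 3), Nat.zero_le (m * m * y ^ 3), Nat.zero_le (m * y ^ 3)]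

/-- The interior level of (BC) from the arithmetic `(n − q)·#𝓑 ≤ (q + 1)·s_{q+1}` and `C(n,q+1)·(q+1) = C(n,q)·(n−q)`. -/
lemma bc_level_succ_of_arith {n q B s : ℕ} (h : (n - q) * B ≤ (q + 1) * s) :
    B * n.choose (q + 1) ≤ s * n.choose q := by
  have hc := Nat.choose_succ_right_eq n q
  have h1 : (B * n.choose (q + 1)) * (q + 1) ≤ (s * n.choose q) * (q + 1) := by
    calc (B * n.choose (q + 1)) * (q + 1) = B * (n.choose (q + 1) * (q + 1)) := by ring
      _ = B * (n.choose q * (n - q)) := by rw [hc]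
      _ = n.choose q * ((n - q) * B) := by ring
      _ ≤ n.choose q * ((q + 1) * s) := Nat.mul_le_mul_left _ h
      _ = (s * n.choose q) * (q + 1) := by ring
  exact Nat.le_of_mul_le_mul_right h1 (by omega)

/-- **THE REPAIRED ROW (BC) HOLDS ON `C₄ + (1, k, k, k)` FOR EVERY `k ≥ 1`** (tight layer `(3k + 4, 3k + 2)`): the
ends by the tree, the interior level by the closed forms. -/
theorem bottomCumulativeTop_kFam (k : ℕ) (hk : 1 ≤ k) :
    BottomCumulativeTop (ears (kFam k)) (3 * k + 4) (3 * k + 2) := by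
  intro v hqv hvp
  have hn : (gr (ears (kFam k))).card = 3 * k + 4 + (3 * k + 2) := by
    rw [card_gr_ears, sum_kFam]; ring
  have hr : (ears (kFam k)).eRank = ((3 * k + 4 : ℕ) : ℕ∞) := by
    rw [eRank_ears, sum_kFam]; congr 1; ring
  have hB := card_Uq_ears (k := kFam k)
  rw [sum_kFam, show 3 * k + 1 + 3 = 3 * k + 4 by ring, show 3 * k + 1 + 1 = 3 * k + 2 by ring] at hB
  rcases Nat.lt_or_ge v (3 * k + 3) with h1 | h1
  · -- v = q
    have : v = 3 * k + 2 := by omega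
    subst this
    exact Nat.mul_le_mul_right _ (card_Uq_le_card_shadowLev _ _ _)
  · rcases Nat.lt_or_ge v (3 * k + 4) with h2 | h2
    · -- v = q + 1
      have : v = 3 * k + 3 := by omega
      subst this
      have hs := card_shadowLev_ears (k := kFam k) (3 * k + 3)
      rw [sum_kFam, show 3 * k + 1 + 3 = 3 * k + 4 by ring, show 3 * k + 1 + 1 = 3 * k + 2 by ring] at hs
      rw [hB, hs]
      have harith := family_bc_interior k hk
      exact bc_level_succ_of_arith (n := 3 * k + 4 + (3 * k + 2)) (q := 3 * k + 2)
        (by rw [show 3 * k + 4 + (3 * k + 2) - (3 * k + 2) = 3 * k + 4 by omega]; exact harith)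
    · -- v = p
      have : v = 3 * k + 4 := by omega
      subst this
      rw [Nat.choose_symm_add]
      exact Nat.mul_le_mul_right _ (card_Uq_le_card_shadowLev_top _ hn hr)

/-- **C-025 ON THE WHOLE FAMILY** (through (BC); Theorem M has it on every tight layer). -/
theorem rls_kFam (k : ℕ) (hk : 1 ≤ k) : ThmN.RLS (ears (kFam k)) (3 * k + 4) (3 * k + 2) :=
  rls_of_bottomCumulativeTop _ _ _ (bottomCumulativeTop_kFam k hk)

end PercRepro.RankDist
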